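import Mathlib
import Literature.NumberTheory.Irrationality.Lai2025TwoAdic.GeneralLinearFormsS
import Literature.NumberTheory.Irrationality.Lai2025TwoAdic.GeneralTwoAdicValuation
import Literature.NumberTheory.Transcendental.TaylorCoeffPadicDiv
import HarnessLib

/-!
# Lai 2025 (IJNT, `2`-adic zeta values), §6 for GENERAL `s`, the `A`-family, part 1: the Leibniz expansion of
# `f^{(s)}`, `f(t) = (t+1)^{s+2}⋯(t+n)^{s+2}·g(t)`, `g(t) = (4t+2n+1)^δ·∏_{k=0}^{n−1}(2t+2k+1)^{s+2}/∏_{k=0}^{n}(4t+4k+1)^{2s+4}`,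
# with `A_n(t+¼) = 2^{(9s+18)n+4s+8}·f(t)`, and the regrouping of its terms at the naturals — PROVED

Topic `Literature/NumberTheory/Irrationality/Lai2025TwoAdic`.  Source: L. Lai, *On the irrationality of certain
`2`-adic zeta values*, Int. J. Number Theory (2025) = arXiv:2304.00816 [Lai2025TwoAdicZeta], §6, proof of Lemma 6.2
(held text `paper:arxiv-2304.00816`, chunks p0011–p0012, read on the page).  PROOF FILE (definitions with bodies +
theorems; no named fact, net debt 0); file 4a of the groundwork for the tree's named fact
`PAdicZetaValues.lai2025TwoAdic_theorem12` (pure `ℚ`-algebra; the `2`-adic valuation count of Lemma 6.2 is the sibling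
`GeneralTwoAdicValuationA.lean`).  The `A`-twin of `GeneralDerivativeExpansion.lean` (B-family), whose Leibniz rule
`divDeriv_finset_prod`, polynomial part `divDeriv_prod_pow`, inverse part `divDeriv_prod_inv` (with `invIdx (2s+2) n`,
i.e. pole order `2s+4`) and regrouping `prod_pow_sub_eq`/`Pfun_natCast`/`Wfun_natCast` are reused; the only new
ingredient is the polynomial block `(4t+2n+1)^δ∏_{k<n}(2t+2k+1)^{s+2}` of `g`.

## Source, as printed ([Lai2025TwoAdicZeta, §6, proof of Lemma 6.2])

«Note that `A_n(t+¼) = 2^{(9s+18)n+4s+8}·f(t)`, where `f(t) = (t+1)^{s+2}(t+2)^{s+2}⋯(t+n)^{s+2}g(t)` and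
`g(t) = (4t+2n+1)^δ · ∏_{k=0}^{n−1}(2t+2k+1)^{s+2}/∏_{k=0}^{n}(4t+4k+1)^{2s+4}`.  So we have
`S_n = 2^{(9s+18)n+4s+8}·∫_{ℤ₂}f^{(s)}(t)dt` … We define the index set `I` by
`I = {(i_1,…,i_n,j) ∈ (ℤ_{≥0})^{n+1} | i_1+⋯+i_n+j = s}`.  Applying the Leibniz rule, we have
`f^{(s)}(t) = Σ_{(i_1,…,i_n,j)∈I} s!/(i_1!⋯i_n!j!) · ((t+1)^{s+2})^{(i_1)}⋯((t+n)^{s+2})^{(i_n)} · g^{(j)}(t)/j!·j!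
 = Σ_I s!binom(s+2,i_1)⋯binom(s+2,i_n)·(t+1)^{s+2−i_1}⋯(t+n)^{s+2−i_n}·g^{(j)}(t)/j! = Σ_I f_{(i_1,…,i_n,j)}(t)`, where
`f_{(i_1,…,i_n,j)}(t) = s!binom(s+2,i_1)⋯binom(s+2,i_n)·g^{(j)}(t)/j!·n!^{2+j}binom(t+n,n)^{2+j}
 × ∏_{k=1}^{n}((k−1)!(n−k)!binom(t+k−1,k−1)binom(t+n,n−k))^{i_k}`.» … «Clearly, we can express `g(t)` as a power series
`g(t) = Σ_k c_k t^k`, where `c_k ∈ 2^kℤ₂` for every `k ≥ 0`.»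

## What is formalised (all PROVED)

* `gA s δ n` (`g`, with `∏_{k≤n}(4t+4k+1)^{−(2s+4)}` written as the product over the tree's `invIdx (2s+2) n`),
  `fA s δ n` (`f`), **`As_add_quarter`** and `As_add_quarter_eq_fA` (`A_n(x+¼) = 2^{(9s+18)n+4s+8}f(x)`).
* The polynomial block of `g` as a product of `δ + (s+2)n` linear factors indexed by `linIdx s δ n`
  (`linFac n γ t = 4t+2n+1` or `2t+2k+1`), `gA_eq_prod`; its divided derivatives `dLin` (value, slope, then `0`) and the
  Leibniz expansion `divDeriv_linBlock`.
* `GAq s δ n c := 𝒟_c g` (the quantity `g^{(j)}/j!` of the source) with the explicit double expansion `GAq_eq` off the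
  poles (linear block × the tree's `divDeriv_prod_inv`), `GAq_zero` (`𝒟_0 g = g`).
* **(eqn_Sum)** `divDeriv_fA` — `𝒟_s f(x) = Σ_{i≤s}[Σ_{ι∈[1,n].piAntidiag i}∏_k binom(s+2,ι_k)(x+k)^{s+2−ι_k}]·𝒟_{s−i}g(x)`
  (`i = i_1+⋯+i_n`, `j = s−i`; the `g`-part kept whole as in the source).
* The regrouping at a natural point: `PhiBinQ` (`binom(j+n,n)^{s+2−i}∏_k(binom(j+k−1,k−1)binom(j+n,n−k))^{ι_k}`),
  `polyTerm_eq` (`∏_k binom(s+2,ι_k)(j+k)^{s+2−ι_k} = coefN·PhiBinQ(j)` with the tree's integer coefficient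
  `coefN s n i ι = ∏binom(s+2,ι_k)·n!^{s+2−i}·∏((k−1)!(n−k)!)^{ι_k}`), and
  **`DAsq_natCast_eq_sum`**: `A_n^{(s)}(j+¼) = s!·2^{(9s+18)n+4s+8}·Σ_{i≤s}Σ_ι coefN·PhiBinQ(j)·𝒟_{s−i}g(j)`.

Cell zeta5-irr / pub-zeta5 (HONEST FRAMING: systematic search; no irrationality claim unless kernel-certified):
calculus bookkeeping for `2`-adic linear forms; nothing here bears on `ζ(5) ∈ ℝ`.
-/

noncomputable section

open Finset Filter Literature.Analysis.Calculus
open Literature.NumberTheory.Transcendental (divDeriv_affine)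
open scoped Nat Topology

namespace Literature.NumberTheory.Irrationality.Lai2025TwoAdic

/-! ## §1. `g`, `f` and `A_n(x+¼) = 2^{(9s+18)n+4s+8}·f(x)` -/

/-- `g(t) := (4t+2n+1)^δ · ∏_{k=0}^{n−1}(2t+2k+1)^{s+2} · ∏_{(a,c) ∈ [0,n]×[0,2s+3]}(4t+4a+1)^{−1}`
(`= (4t+2n+1)^δ∏_{k<n}(2t+2k+1)^{s+2}/∏_{k≤n}(4t+4k+1)^{2s+4}`). [cite: Lai2025TwoAdicZeta, Lemma 6.2 (proof: the display defining g(t))] -/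
def gA (s δ n : ℕ) (t : ℚ) : ℚ :=
  (4 * t + 2 * n + 1) ^ δ * (∏ k ∈ range n, (2 * t + 2 * k + 1)) ^ (s + 2) *
    ∏ α ∈ invIdx (2 * s + 2) n, (4 * t + 4 * (α.1 : ℚ) + 1)⁻¹

/-- `f(t) := (t+1)^{s+2}(t+2)^{s+2}⋯(t+n)^{s+2}·g(t)`. [cite: Lai2025TwoAdicZeta, Lemma 6.2 (proof: the display defining f(t))] -/
def fA (s δ n : ℕ) (t : ℚ) : ℚ := (∏ k ∈ Icc 1 n, (t + k) ^ (s + 2)) * gA s δ n t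

/-- `∏_{k ∈ [1,n]}(x+k) = ∏_{j<n}(x+1+j)`. [folklore] -/
private theorem prod_Icc_eq_prod_range' (n : ℕ) (x : ℚ) :
    ∏ k ∈ Icc 1 n, (x + k) = ∏ j ∈ range n, (x + 1 + j) := by
  rw [← Finset.Ico_add_one_right_eq_Icc, Finset.prod_Ico_eq_prod_range, Nat.add_sub_cancel]
  exact prod_congr rfl fun j _ => by push_cast; ring

/-- **`A_n(x + ¼)` in product form**: `A_n(x+¼) = 2^{(9s+18)n+4s+8}·(4x+2n+1)^δ·(∏_{j<n}(2x+2j+1))^{s+2}(∏_{j<n}(x+1+j))^{s+2}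
/ (∏_{j≤n}(4x+4j+1))^{2s+4}` — the display «`A_n(t+¼) = 2^{(9s+18)n+4s+8}·f(t)`» (valid for every rational `x`; both sides
vanish at the shifted poles by the `x/0 = 0` convention). [cite: Lai2025TwoAdicZeta, Lemma 6.2 (proof, the displays for A_n(t+¼), f, g)] -/
theorem As_add_quarter (s δ n : ℕ) (x : ℚ) :
    As s δ n (x + 1 / 4) = (2 : ℚ) ^ ((9 * s + 18) * n + 4 * s + 8) * (4 * x + 2 * n + 1) ^ δ *
      ((∏ j ∈ range n, (2 * x + 2 * j + 1)) ^ (s + 2) * (∏ j ∈ range n, (x + 1 + j)) ^ (s + 2)) /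
      (∏ j ∈ range (n + 1), (4 * x + 4 * j + 1)) ^ (2 * s + 4) := by
  have hlin : 4 * (x + 1 / 4) + 2 * (n : ℚ) = 4 * x + 2 * n + 1 := by ring
  have h1 : ∏ j ∈ range n, (x + 1 / 4 + 1 / 4 + j) = (∏ j ∈ range n, (2 * x + 2 * j + 1)) / (2 : ℚ) ^ n := by
    calc ∏ j ∈ range n, (x + 1 / 4 + 1 / 4 + j) = ∏ j ∈ range n, ((2 * x + 2 * j + 1) / 2) :=
          prod_congr rfl fun j _ => by ring
      _ = (∏ j ∈ range n, (2 * x + 2 * j + 1)) / ∏ _j ∈ range n, (2 : ℚ) := prod_div_distrib _ _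
      _ = _ := by rw [prod_const, card_range]
  have h3 : ∏ j ∈ range n, (x + 1 / 4 + 3 / 4 + j) = ∏ j ∈ range n, (x + 1 + j) :=
    prod_congr rfl fun j _ => by ring
  have hden : ∏ j ∈ range (n + 1), (x + 1 / 4 + j) =
      (∏ j ∈ range (n + 1), (4 * x + 4 * j + 1)) / (4 : ℚ) ^ (n + 1) := by
    calc ∏ j ∈ range (n + 1), (x + 1 / 4 + j) = ∏ j ∈ range (n + 1), ((4 * x + 4 * j + 1) / 4) :=
          prod_congr rfl fun j _ => by ring
      _ = (∏ j ∈ range (n + 1), (4 * x + 4 * j + 1)) / ∏ _j ∈ range (n + 1), (4 : ℚ) :=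
          prod_div_distrib _ _
      _ = _ := by rw [prod_const, card_range]
  set U := ∏ j ∈ range n, (2 * x + 2 * j + 1) with hU
  set P := ∏ j ∈ range n, (x + 1 + j) with hP
  set V := ∏ j ∈ range (n + 1), (4 * x + 4 * j + 1) with hV
  rw [As, hlin, h1, h3, hden]
  have h4 : ((4 : ℚ) ^ (n + 1)) ^ (2 * s + 4) = 2 ^ (2 * ((n + 1) * (2 * s + 4))) := by
    rw [show (4 : ℚ) = 2 ^ 2 by norm_num, ← pow_mul, ← pow_mul]
  have h2 : ((2 : ℚ) ^ n) ^ (s + 2) = 2 ^ (n * (s + 2)) := by rw [← pow_mul]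
  by_cases hV0 : V = 0
  · rw [hV0, zero_div, zero_pow (by omega), div_zero, div_zero]
  · have hV' : V ^ (2 * s + 4) ≠ 0 := pow_ne_zero _ hV0
    rw [div_pow, div_pow, h4, h2]
    have key : (2 : ℚ) ^ ((6 * s + 12) * n) * 2 ^ (2 * ((n + 1) * (2 * s + 4))) =
        2 ^ ((9 * s + 18) * n + 4 * s + 8) * 2 ^ (n * (s + 2)) := by
      rw [← pow_add, ← pow_add]; congr 1; ring
    field_simp
    linear_combination ((4 * x + 2 * (n : ℚ) + 1) ^ δ * U ^ (s + 2) * P ^ (s + 2)) * key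

/-- **`A_n(x+¼) = 2^{(9s+18)n+4s+8}·f(x)`** for every rational `x`. [cite: Lai2025TwoAdicZeta, Lemma 6.2 (proof: "A_n(t+¼) = 2^{(9s+18)n+4s+8}·f(t)")] -/
theorem As_add_quarter_eq_fA (s δ n : ℕ) (x : ℚ) :
    As s δ n (x + 1 / 4) = (2 : ℚ) ^ ((9 * s + 18) * n + 4 * s + 8) * fA s δ n x := by
  rw [As_add_quarter, fA, gA, prod_invIdx_inv, show 2 * s + 2 + 2 = 2 * s + 4 by ring, ← prod_Icc_eq_prod_range',
    prod_pow, div_eq_mul_inv]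
  ring

/-! ## §2. The polynomial block of `g` as a product of linear factors -/

/-- The index set of the linear factors of `g`: `(c, n)` with `c < δ` labels the factor `4t+2n+1`, and `(c, k)` with
`c < s+2`, `k < n` labels a copy of `2t+2k+1`. [cite: Lai2025TwoAdicZeta, Lemma 6.2 (proof: g(t) = (4t+2n+1)^δ∏_{k<n}(2t+2k+1)^{s+2}/…)] -/
def linIdx (s δ n : ℕ) : Finset (ℕ × ℕ) := (range δ ×ˢ {n}) ∪ (range (s + 2) ×ˢ range n)

/-- The slope of the linear factor `γ`: `4` for the factor `4t+2n+1`, `2` for `2t+2k+1`. [cite: Lai2025TwoAdicZeta, Lemma 6.2 (proof: g)] -/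
def linSlope (n : ℕ) (γ : ℕ × ℕ) : ℕ := if γ.2 = n then 4 else 2

/-- The constant term of the linear factor `γ`: `2n+1`, resp. `2k+1` (odd). [cite: Lai2025TwoAdicZeta, Lemma 6.2 (proof: g)] -/
def linShift (n : ℕ) (γ : ℕ × ℕ) : ℕ := if γ.2 = n then 2 * n + 1 else 2 * γ.2 + 1

/-- The linear factor `γ` of `g`: `linSlope·t + linShift`. [cite: Lai2025TwoAdicZeta, Lemma 6.2 (proof: g)] -/
def linFac (n : ℕ) (γ : ℕ × ℕ) (t : ℚ) : ℚ := (linSlope n γ : ℚ) * t + (linShift n γ : ℚ)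

/-- The two parts of `linIdx` are disjoint (second coordinate `= n` versus `< n`). [folklore] -/
private theorem disjoint_linIdx (s δ n : ℕ) : Disjoint (range δ ×ˢ ({n} : Finset ℕ)) (range (s + 2) ×ˢ range n) := by
  rw [disjoint_left]
  intro γ h1 h2
  have h1' := (mem_product.1 h1).2
  have h2' := (mem_product.1 h2).2
  rw [mem_singleton] at h1'
  rw [mem_range] at h2'
  omega

/-- **The polynomial block of `g` as a product of linear factors:**
`∏_{γ ∈ linIdx} linFac γ (t) = (4t+2n+1)^δ · (∏_{k<n}(2t+2k+1))^{s+2}`. [cite: Lai2025TwoAdicZeta, Lemma 6.2 (proof: the display defining g)] -/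
theorem prod_linIdx (s δ n : ℕ) (t : ℚ) :
    ∏ γ ∈ linIdx s δ n, linFac n γ t = (4 * t + 2 * n + 1) ^ δ * (∏ k ∈ range n, (2 * t + 2 * k + 1)) ^ (s + 2) := by
  rw [linIdx, prod_union (disjoint_linIdx s δ n), prod_product, prod_product]
  congr 1
  · have e : ∀ c ∈ range δ, ∏ k ∈ ({n} : Finset ℕ), linFac n (c, k) t = 4 * t + 2 * n + 1 := fun c _ => by
      rw [prod_singleton, linFac, linSlope, linShift, if_pos rfl, if_pos rfl]; push_cast; ring
    rw [prod_congr rfl e, prod_const, card_range]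
  · have e : ∀ c ∈ range (s + 2), ∏ k ∈ range n, linFac n (c, k) t = ∏ k ∈ range n, (2 * t + 2 * k + 1) :=
      fun c _ => prod_congr rfl fun k hk => by
        have hk' : k ≠ n := (mem_range.1 hk).ne
        rw [linFac, linSlope, linShift, if_neg hk', if_neg hk']; push_cast; ring
    rw [prod_congr rfl e, prod_const, card_range]

/-- `g = (∏_{γ ∈ linIdx} linFac γ) · ∏_{α ∈ invIdx (2s+2) n}(4t+4a+1)^{−1}`. [cite: Lai2025TwoAdicZeta, Lemma 6.2 (proof: g)] -/
theorem gA_eq_prod (s δ n : ℕ) (t : ℚ) :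
    gA s δ n t = (∏ γ ∈ linIdx s δ n, linFac n γ t) * ∏ α ∈ invIdx (2 * s + 2) n, (4 * t + 4 * (α.1 : ℚ) + 1)⁻¹ := by
  rw [gA, prod_linIdx]

/-! ## §3. The divided derivatives of the linear block -/

/-- The divided derivatives of a linear factor: the value, then the slope, then `0`. [cite: Lai2025TwoAdicZeta, Lemma 6.2 (proof: "g(t) = Σ c_k t^k, c_k ∈ 2^kℤ₂")] -/
def dLin (n : ℕ) (γ : ℕ × ℕ) (μ : ℕ) (x : ℚ) : ℚ :=
  if μ = 0 then linFac n γ x else if μ = 1 then (linSlope n γ : ℚ) else 0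

/-- `𝒟_μ(linFac γ)(x) = dLin γ μ x`. [cite: Lai2025TwoAdicZeta, Lemma 6.2 (proof: the derivatives of g)] -/
theorem divDeriv_linFac (n : ℕ) (γ : ℕ × ℕ) (μ : ℕ) (x : ℚ) : divDeriv μ (linFac n γ) x = dLin n γ μ x := by
  rw [show linFac n γ = fun t : ℚ => (linSlope n γ : ℚ) * t + (linShift n γ : ℚ) from rfl, divDeriv_affine, dLin, linFac]

/-- **Leibniz over the linear block:** `𝒟_b(∏_γ linFac γ)(x) = Σ_{μ ∈ linIdx.piAntidiag b} ∏_γ dLin γ (μ_γ) x`.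
[cite: Lai2025TwoAdicZeta, Lemma 6.2 (proof: "Applying the Leibniz rule")] -/
theorem divDeriv_linBlock (s δ n b : ℕ) (x : ℚ) :
    divDeriv b (fun t => ∏ γ ∈ linIdx s δ n, linFac n γ t) x =
      ∑ μ ∈ (linIdx s δ n).piAntidiag b, ∏ γ ∈ linIdx s δ n, dLin n γ (μ γ) x := by
  classical
  have hsm : ∀ γ ∈ linIdx s δ n, ContDiffAt ℚ (⊤ : ℕ∞) (linFac n γ) x := fun γ _ => by
    show ContDiffAt ℚ (⊤ : ℕ∞) (fun t : ℚ => (linSlope n γ : ℚ) * t + (linShift n γ : ℚ)) x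
    fun_prop
  rw [divDeriv_finset_prod (linIdx s δ n) (linFac n) hsm b]
  exact sum_congr rfl fun μ _ => prod_congr rfl fun γ _ => divDeriv_linFac n γ (μ γ) x

/-- The linear block is smooth. [cite: Lai2025TwoAdicZeta, Lemma 6.2 (proof)] -/
theorem contDiffAt_linBlock (s δ n : ℕ) (x : ℚ) {N : WithTop ℕ∞} :
    ContDiffAt ℚ N (fun t => ∏ γ ∈ linIdx s δ n, linFac n γ t) x := by
  refine contDiffAt_prod fun γ _ => ?_
  show ContDiffAt ℚ N (fun t : ℚ => (linSlope n γ : ℚ) * t + (linShift n γ : ℚ)) x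
  fun_prop

/-! ## §4. `𝒟_c g` (the source's `g^{(j)}/j!`) and its explicit expansion -/

/-- `GAq s δ n c x := 𝒟_c g(x) = g^{(c)}(x)/c!`. [cite: Lai2025TwoAdicZeta, Lemma 6.2 (proof: the factor g^{(j)}(t)/j! of f_{(i_1,…,i_n,j)})] -/
def GAq (s δ n c : ℕ) (x : ℚ) : ℚ := divDeriv c (gA s δ n) x

/-- `𝒟_0 g = g`. [cite: Lai2025TwoAdicZeta, Lemma 6.2 (proof: the dominating term carries g itself)] -/
theorem GAq_zero (s δ n : ℕ) (x : ℚ) : GAq s δ n 0 x = gA s δ n x := by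
  rw [GAq, divDeriv_zero]

/-- The inverse block is smooth off its poles. [cite: Lai2025TwoAdicZeta, Lemma 6.2 (proof)] -/
theorem contDiffAt_invBlock (s n : ℕ) {x : ℚ} (hx : ∀ a ∈ range (n + 1), 4 * x + 4 * (a : ℚ) + 1 ≠ 0)
    {N : WithTop ℕ∞} : ContDiffAt ℚ N (fun t : ℚ => ∏ α ∈ invIdx (2 * s + 2) n, (4 * t + 4 * (α.1 : ℚ) + 1)⁻¹) x := by
  have hx' : ∀ α ∈ invIdx (2 * s + 2) n, 4 * x + 4 * (α.1 : ℚ) + 1 ≠ 0 := fun α hα =>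
    hx α.1 (mem_product.1 hα).1
  refine contDiffAt_prod fun α hα => ?_
  exact ((contDiffAt_const.mul contDiffAt_id).add contDiffAt_const |>.add contDiffAt_const).inv (hx' α hα)

/-- `g` is smooth off the poles `4x + 4a + 1 = 0` (`a ≤ n`), in particular at the naturals. [cite: Lai2025TwoAdicZeta, Lemma 6.2 (proof)] -/
theorem contDiffAt_gA (s δ n : ℕ) {x : ℚ} (hx : ∀ a ∈ range (n + 1), 4 * x + 4 * (a : ℚ) + 1 ≠ 0)
    {N : WithTop ℕ∞} : ContDiffAt ℚ N (gA s δ n) x := by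
  have e : gA s δ n = fun t => (∏ γ ∈ linIdx s δ n, linFac n γ t) *
      ∏ α ∈ invIdx (2 * s + 2) n, (4 * t + 4 * (α.1 : ℚ) + 1)⁻¹ := funext (gA_eq_prod s δ n)
  rw [e]
  exact (contDiffAt_linBlock s δ n x).mul (contDiffAt_invBlock s n hx)

/-- **The explicit expansion of `𝒟_c g`** (off the poles): `𝒟_c g(x) = Σ_{b≤c} [Σ_{μ ∈ linIdx.piAntidiag b}∏_γ dLin γ μ_γ x]
· [Σ_{λ ∈ invIdx.piAntidiag (c−b)} ∏_α (−4)^{λ_α}(4x+4a+1)^{−(λ_α+1)}]` — every term is a product of odd integers, slopes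
`2, 4`, and `(−4)^λ(4x+4a+1)^{−λ−1}` («`g(t) = Σ c_kt^k`, `c_k ∈ 2^kℤ₂`»).
[cite: Lai2025TwoAdicZeta, Lemma 6.2 (proof: (eqn_5_2) and "c_k ∈ 2^kℤ₂")] -/
theorem GAq_eq (s δ n c : ℕ) {x : ℚ} (hx : ∀ a ∈ range (n + 1), 4 * x + 4 * (a : ℚ) + 1 ≠ 0) :
    GAq s δ n c x = ∑ b ∈ range (c + 1),
      (∑ μ ∈ (linIdx s δ n).piAntidiag b, ∏ γ ∈ linIdx s δ n, dLin n γ (μ γ) x) *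
      (∑ lam ∈ (invIdx (2 * s + 2) n).piAntidiag (c - b), ∏ α ∈ invIdx (2 * s + 2) n,
        (-4 : ℚ) ^ (lam α) * ((4 * x + 4 * (α.1 : ℚ) + 1) ^ (lam α + 1))⁻¹) := by
  have e : gA s δ n = fun t => (∏ γ ∈ linIdx s δ n, linFac n γ t) *
      ∏ α ∈ invIdx (2 * s + 2) n, (4 * t + 4 * (α.1 : ℚ) + 1)⁻¹ := funext (gA_eq_prod s δ n)
  rw [GAq, e, divDeriv_fun_mul (contDiffAt_linBlock s δ n x) (contDiffAt_invBlock s n hx)]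
  refine sum_congr rfl fun b _ => ?_
  rw [divDeriv_linBlock, divDeriv_prod_inv (2 * s + 2) n (c - b) hx]

/-! ## §5. (eqn_Sum): the Leibniz expansion of `𝒟_s f` with the `g`-part kept whole -/

/-- `f` is smooth at every point off the poles of `g`. [cite: Lai2025TwoAdicZeta, Lemma 6.2 (proof)] -/
theorem contDiffAt_fA (s δ n : ℕ) {x : ℚ} (hx : ∀ a ∈ range (n + 1), 4 * x + 4 * (a : ℚ) + 1 ≠ 0) (r : ℕ) :
    ContDiffAt ℚ r (fA s δ n) x := by
  have h1 : ContDiffAt ℚ r (fun t : ℚ => ∏ k ∈ Icc 1 n, (t + k) ^ (s + 2)) x := by fun_prop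
  have hf : fA s δ n = fun t : ℚ => (∏ k ∈ Icc 1 n, (t + (k : ℚ)) ^ (s + 2)) * gA s δ n t := rfl
  rw [hf]; exact h1.mul (contDiffAt_gA s δ n hx)

/-- **(eqn_Sum) for the `A`-family:** off the poles of `g`,
`𝒟_s f(x) = Σ_{i ≤ s} [Σ_{ι ∈ [1,n].piAntidiag i} ∏_k binom(s+2,ι_k)(x+k)^{s+2−ι_k}] · 𝒟_{s−i} g(x)`.
[cite: Lai2025TwoAdicZeta, Lemma 6.2 (proof, (eqn_Sum) and the definition of f_{(i_1,…,i_n,j)})] -/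
theorem divDeriv_fA (s δ n : ℕ) {x : ℚ} (hx : ∀ a ∈ range (n + 1), 4 * x + 4 * (a : ℚ) + 1 ≠ 0) :
    divDeriv s (fA s δ n) x = ∑ i ∈ range (s + 1),
      (∑ ι ∈ (Icc 1 n).piAntidiag i, ∏ k ∈ Icc 1 n, (((s + 2).choose (ι k) : ℕ) : ℚ) * (x + k) ^ (s + 2 - ι k)) *
      GAq s δ n (s - i) x := by
  have h1 : ContDiffAt ℚ s (fun t : ℚ => ∏ k ∈ Icc 1 n, (t + k) ^ (s + 2)) x := by fun_prop
  have hf : fA s δ n = fun t : ℚ => (∏ k ∈ Icc 1 n, (t + (k : ℚ)) ^ (s + 2)) * gA s δ n t := rfl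
  rw [hf, divDeriv_fun_mul h1 (contDiffAt_gA s δ n hx)]
  refine sum_congr rfl fun i _ => ?_
  rw [divDeriv_prod_pow, GAq]

/-! ## §6. The terms at a natural point: `coefN · PhiBinQ(j) · 𝒟_{s−i}g(j)` -/

/-- The binomial part of the term `(i, ι)` at a natural `j`:
`binom(j+n,n)^{s+2−i} · ∏_k (binom(j+k−1,k−1)binom(j+n,n−k))^{ι_k}`. [cite: Lai2025TwoAdicZeta, Lemma 6.2 (proof: f_{(i_1,…,i_n,j)})] -/
def PhiBinQ (s n i : ℕ) (ι : ℕ → ℕ) (j : ℕ) : ℚ :=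
  ((j + n).choose n : ℚ) ^ (s + 2 - i) *
    ∏ k ∈ Icc 1 n, (((j + (k - 1)).choose (k - 1) : ℚ) * ((j + n).choose (n - k) : ℚ)) ^ ι k

/-- **The regrouped polynomial term** at a natural point: for `Σι = i ≤ s`,
`∏_k binom(s+2,ι_k)(j+k)^{s+2−ι_k} = coefN · PhiBinQ(j)` with the tree's integer coefficient
`coefN = ∏binom(s+2,ι_k)·n!^{s+2−i}·∏((k−1)!(n−k)!)^{ι_k}` («`(t+1)⋯(t+n) = n!binom(t+n,n)`»,
«`(k−1)!(n−k)!binom(t+k−1,k−1)binom(t+n,n−k)`»). [cite: Lai2025TwoAdicZeta, Lemma 6.2 (proof: the display for f_{(i_1,…,i_n,j)})] -/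
theorem polyTerm_eq (s n : ℕ) {i : ℕ} (hi : i ≤ s) {ι : ℕ → ℕ} (hι : ι ∈ (Icc 1 n).piAntidiag i) (j : ℕ) :
    ∏ k ∈ Icc 1 n, (((s + 2).choose (ι k) : ℕ) : ℚ) * ((j : ℚ) + k) ^ (s + 2 - ι k) =
      (coefN s n i ι : ℚ) * PhiBinQ s n i ι j := by
  have hx : ∀ k ∈ Icc 1 n, (j : ℚ) + k ≠ 0 := fun k hk => by
    have := (mem_Icc.1 hk).1; positivity
  rw [prod_mul_distrib, prod_pow_sub_eq s n (by omega) hι hx, Pfun_natCast, mul_pow]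
  have hW : ∀ k ∈ Icc 1 n, Wfun n k j ^ ι k =
      ((Ffac n k : ℕ) : ℚ) ^ ι k * (((j + (k - 1)).choose (k - 1) : ℚ) * ((j + n).choose (n - k) : ℚ)) ^ ι k := by
    intro k hk
    rw [Wfun_natCast n j hk, ← mul_pow, Ffac]; push_cast; ring
  rw [prod_congr rfl hW, prod_mul_distrib, coefN, PhiBinQ]
  push_cast
  ring

/-- **(eqn_Sum) at a natural point:** `A_n^{(s)}(j+¼) = s!·2^{(9s+18)n+4s+8}·Σ_{i≤s}Σ_ι coefN·PhiBinQ(j)·𝒟_{s−i}g(j)` (`δ ≤ 1`).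
[cite: Lai2025TwoAdicZeta, Lemma 6.2 (proof: S_n = 2^{(9s+18)n+4s+8}∫f^{(s)}, (eqn_Sum))] -/
theorem DAsq_natCast_eq_sum (s : ℕ) {δ : ℕ} (hδ : δ ≤ 1) (n j : ℕ) :
    DAsq s δ n j = (s ! : ℚ) * 2 ^ ((9 * s + 18) * n + 4 * s + 8) *
      ∑ i ∈ range (s + 1), ∑ ι ∈ (Icc 1 n).piAntidiag i,
        (coefN s n i ι : ℚ) * (PhiBinQ s n i ι j * GAq s δ n (s - i) j) := by
  have hx : ∀ a ∈ range (n + 1), 4 * (j : ℚ) + 4 * (a : ℚ) + 1 ≠ 0 := fun a _ => by positivity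
  have hf : (fun y : ℚ => As s δ n (y + 1 / 4)) = fun y => (2 : ℚ) ^ ((9 * s + 18) * n + 4 * s + 8) * fA s δ n y :=
    funext (As_add_quarter_eq_fA s δ n)
  rw [DAsq_natCast s hδ, hf, iteratedDeriv_const_mul _ (contDiffAt_fA s δ n hx s),
    iteratedDeriv_eq_factorial_mul_divDeriv, divDeriv_fA s δ n hx]
  have e : ∑ i ∈ range (s + 1),
      (∑ ι ∈ (Icc 1 n).piAntidiag i, ∏ k ∈ Icc 1 n, (((s + 2).choose (ι k) : ℕ) : ℚ) * ((j : ℚ) + k) ^ (s + 2 - ι k)) *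
      GAq s δ n (s - i) j =
      ∑ i ∈ range (s + 1), ∑ ι ∈ (Icc 1 n).piAntidiag i,
        (coefN s n i ι : ℚ) * (PhiBinQ s n i ι j * GAq s δ n (s - i) j) := by
    refine sum_congr rfl fun i hi => ?_
    rw [sum_mul]
    exact sum_congr rfl fun ι hι => by
      rw [polyTerm_eq s n (by have := mem_range.1 hi; omega) hι j]; ring
  rw [e]; ring

end Literature.NumberTheory.Irrationality.Lai2025TwoAdic
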